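import Summits.KontsevichZagierPeriods.KontsevichZagierPeriods.Theorems.RootDecompRationalCubeDichotomyRankDescentP13

/-! # `RootDecompRationalCubeDichotomyRankDescentP14` — part 14/14 of the mechanical ≤400-line split of `RankDescent_v12_landing.lean` (sha256 00885b8b9882f02e…)
Source: decomp-kz lens-2 g13 `RankDescent_v12.lean` (HOME/decomp-kz-lens-2/g13/, sha256 00885b8b…; critic g5-18…g5-66 CLEARED as NODE v1–v12 for crux stmt-KontsevichZagierPeriods-26322 RationalCubePiKernelSingle: rank dichotomy single_of_fullRankGeTwo + RankLeOneKernel, de Rham-exact descent, linear-in-one-variable / hyperbola / Fermat–hyperbolic / conic classes, transport kit, Brieskorn module; writer g7 l.1222: «landing split §0–4 ∣ … ∣ §16 --supports 26322 endorsed»); `#print axioms` pins removed; landed by census-1 g9.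
Split by census-1 g9 `gen/splitlean.py`: scopes re-opened with their `open`/`variable`/`set_option` context; mathematics and declaration order unchanged. -/

noncomputable section
open MeasureTheory Set MvPolynomial
open Literature.NumberTheory.Transcendental
open Literature.NumberTheory.Transcendental.KZ
namespace Summit.KontsevichZagierPeriods.RootDecompRationalCubeDichotomy.Rung26322.RankDescent
variable {M : ℕ}

/-- Over the Fermat cubic `1 + x³ + y³`: `x³ ↦ −1/2` (`3x³ ≡ 3y³`, `1 + x³ + y³ ≡ 0`). -/
example : bpMonRed 1 1 1 2 2 3 0 = (C (-1/2 : ℚ) : MvPolynomial (Fin 2) ℚ) := by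
  simp [bpMonRed, bpK, kx, ky, bpS]
  norm_num

/-! ## §16 (v12) THE BRIESKORN MODULE — for EVERY denominator `Q ∈ ℚ[x,y]`: the two universal relation families `Q·h ≡ 0` and `{Q, h} ≡ 0`

The rotation field of §13, the Hamiltonian field of §15 and the Lie field of §8 are all instances of ONE identity valid for every `Q`: the Poisson bracket
`{Q, h} = ∂_x Q · ∂_y h − ∂_y Q · ∂_x h` lies in `Ex0 Q` (potentials `(−∂_y Q · h, ∂_x Q · h)`, i.e. `d(h · ⋆dQ)`; uses only `∂_x∂_y = ∂_y∂_x`). Hence the `ℚ`-submodule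
`Brieskorn Q := Q·ℚ[x,y] + {Q, ℚ[x,y]}` (the image of `t·H'' + dQ ∧ dΩ⁰` in `Ω²`) consists of exact numerators, for every `Q` of every degree, and 26322 is DECIDED (N = 0) on it;
the residual is the quotient `ℚ[x,y] / Brieskorn Q` — finite-dimensional of dimension the global Milnor number `μ(Q)` for tame `Q` (the functionals of §8, §13, §14, §15 are explicit
splittings of this quotient: `μ ≤ 1` in degree ≤ 2, `μ = pq` for Brieskorn–Pham). -/

/-- The Poisson bracket `{Q, h} = Q_x h_y − Q_y h_x`. [folklore] -/
def pb (Q h : MvPolynomial (Fin 2) ℚ) : MvPolynomial (Fin 2) ℚ := pderiv 0 Q * pderiv 1 h - pderiv 1 Q * pderiv 0 h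

/-- Auxiliary step `pb_add` (§16): pb add. [bookkeeping] -/
theorem pb_add (Q h h' : MvPolynomial (Fin 2) ℚ) : pb Q (h + h') = pb Q h + pb Q h' := by
  unfold pb; simp only [map_add]; ring

/-- Auxiliary step `pb_smul` (§16): pb smul. [bookkeeping] -/
theorem pb_smul (Q h : MvPolynomial (Fin 2) ℚ) (k : ℚ) : pb Q (k • h) = k • pb Q h := by
  unfold pb
  simp only [smul_eq_C_mul, Derivation.leibniz, pderiv_C, smul_eq_mul, mul_zero, add_zero]
  ring

/-- Auxiliary step `pb_self` (§16): pb self. [bookkeeping] -/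
theorem pb_self (Q : MvPolynomial (Fin 2) ℚ) : pb Q Q = 0 := by unfold pb; ring

/-- **`{Q, h} ∈ Ex0 Q` for EVERY `Q`, `h`** (potentials `(−Q_y h, Q_x h)`; `div` of the Hamiltonian field vanishes by `pderiv_comm`). [folklore] -/
theorem pb_mem (Q h : MvPolynomial (Fin 2) ℚ) : pb Q h ∈ Ex0 Q := by
  refine mem_ex0_iff.mpr ⟨![-(pderiv 1 Q * h), pderiv 0 Q * h], ?_⟩
  have hc := pderiv_comm 0 1 Q
  simp only [Fin.sum_univ_two, Matrix.cons_val_zero, Matrix.cons_val_one, exS, pb, map_neg, Derivation.leibniz, smul_eq_mul,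
    Nat.cast_zero, zero_add, map_one, one_mul, hc]
  ring

/-- **The Brieskorn module** `Q·ℚ[x,y] + {Q, ℚ[x,y]}` (as a `ℚ`-submodule of numerators). [folklore] -/
def Brieskorn (Q : MvPolynomial (Fin 2) ℚ) : Submodule ℚ (MvPolynomial (Fin 2) ℚ) :=
  Submodule.span ℚ (Set.range (fun h : MvPolynomial (Fin 2) ℚ => Q * h) ∪ Set.range (fun h : MvPolynomial (Fin 2) ℚ => pb Q h))

/-- Auxiliary step `mul_mem_brieskorn` (§16): mul mem brieskorn. [bookkeeping] -/
theorem mul_mem_brieskorn (Q h : MvPolynomial (Fin 2) ℚ) : Q * h ∈ Brieskorn Q :=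
  Submodule.subset_span (Or.inl ⟨h, rfl⟩)

/-- Auxiliary step `pb_mem_brieskorn` (§16): pb mem brieskorn. [bookkeeping] -/
theorem pb_mem_brieskorn (Q h : MvPolynomial (Fin 2) ℚ) : pb Q h ∈ Brieskorn Q :=
  Submodule.subset_span (Or.inr ⟨h, rfl⟩)

/-- **`Brieskorn Q ≤ Ex0 Q`**: every element of the Brieskorn module is an exact numerator (`s = 0`). [folklore] -/
theorem brieskorn_le_ex0 (Q : MvPolynomial (Fin 2) ℚ) : Brieskorn Q ≤ Ex0 Q := by
  apply Submodule.span_le.mpr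
  rintro P (⟨h, rfl⟩ | ⟨h, rfl⟩)
  · exact mul_mem_ex0 Q h
  · exact pb_mem Q h

/-- Auxiliary step `drExact_of_brieskorn` (§16): dr Exact of brieskorn. [bookkeeping] -/
theorem drExact_of_brieskorn {Q P : MvPolynomial (Fin 2) ℚ} (h : P ∈ Brieskorn Q) : DRExact P Q :=
  drExact_of_ex0 (brieskorn_le_ex0 Q h)

/-- The earlier relation families are Brieskorn elements: §13's rotation-field relation is `{normQ a₀ D, h}/2`… stated as: `pb (normQ a₀ D) h = 2·(X 0 · ∂_y h + D·X 1 · ∂_x h)`. [folklore] -/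
theorem pb_normQ (a₀ D : ℚ) (h : MvPolynomial (Fin 2) ℚ) :
    pb (normQ a₀ D) h = C 2 * (X 0 * pderiv 1 h + C D * X 1 * pderiv 0 h) := by
  simp only [pb, normQ, map_add, map_sub, pderiv_C, Derivation.leibniz, Derivation.leibniz_pow, smul_eq_mul, pderiv_X_self,
    pderiv_one_X_zero, pderiv_zero_X_one, nsmul_eq_mul, Nat.cast_ofNat, mul_one, mul_zero, add_zero, zero_add, sub_zero, zero_sub,
    Nat.add_one_sub_one, pow_one, map_ofNat]
  all_goals ring

/-- §15's Hamiltonian relation is `−{bpQ, h}`: `pb (bpQ c α β p q) h = (p+1)α x^p ∂_y h − (q+1)β y^q ∂_x h`. [folklore] -/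
theorem pb_bpQ (c α β : ℚ) (p q : ℕ) (h : MvPolynomial (Fin 2) ℚ) :
    pb (bpQ c α β p q) h = C (((p : ℚ) + 1) * α) * X 0 ^ p * pderiv 1 h - C (((q : ℚ) + 1) * β) * X 1 ^ q * pderiv 0 h := by
  simp only [pb, bpQ, map_add, pderiv_C, Derivation.leibniz, Derivation.leibniz_pow, smul_eq_mul, pderiv_X_self,
    pderiv_one_X_zero, pderiv_zero_X_one, nsmul_eq_mul, mul_one, mul_zero, add_zero, zero_add, smul_zero, Nat.cast_add, Nat.cast_one,
    Nat.add_one_sub_one]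
  simp only [map_mul, map_add, map_one, map_natCast]
  ring

/-- §8's hyperbola: `pb (hypQ q₀) h = y ∂_y h − x ∂_x h` (the Euler-type field of `xy`). [folklore] -/
theorem pb_hypQ (q₀ : ℚ) (h : MvPolynomial (Fin 2) ℚ) : pb (hypQ q₀) h = X 1 * pderiv 1 h - X 0 * pderiv 0 h := by
  simp only [pb, hypQ, map_add, pderiv_C, Derivation.leibniz, smul_eq_mul, pderiv_X_self, pderiv_one_X_zero, pderiv_zero_X_one,
    mul_one, mul_zero, add_zero, zero_add]

/-- **DECIDED (m = 2, PROVED, N = 0) ON THE BRIESKORN MODULE OF EVERY DENOMINATOR:** `Q` zero-free on the square, value `0`, numerator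
`P ∈ Q·ℚ[x,y] + {Q, ℚ[x,y]}` ⟹ `[ [0,1]², P/Q ] ∈ relations`. [cite: KontsevichZagier2001, §1.2] -/
theorem brieskorn_two_mem_relations (Q : MvPolynomial (Fin 2) ℚ) (r : IntegralRep 2) (P : MvPolynomial (Fin 2) ℚ) (hP : P ∈ Brieskorn Q)
    (hd : r.domain = Set.pi Set.univ (fun _ : Fin 2 => Set.Icc (0:ℝ) 1))
    (hQ : ∀ z ∈ Set.pi Set.univ (fun _ : Fin 2 => Set.Icc (0:ℝ) 1), MvPolynomial.aeval z Q ≠ 0)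
    (hf : ∀ z ∈ Set.pi Set.univ (fun _ : Fin 2 => Set.Icc (0:ℝ) 1), r.integrand z = MvPolynomial.aeval z P / MvPolynomial.aeval z Q)
    (h0 : r.value = 0) : of r ∈ relations := by
  obtain ⟨s, G, hid⟩ := drExact_of_brieskorn hP
  exact mem_relations_of_exact_two r _ _ s G hid hd hQ hf h0

/-- The GENERIC residual of a denominator `Q`: numerators OUTSIDE the Brieskorn module (a quotient of dimension `μ(Q)` for tame `Q`). [folklore] -/
def BrieskornResidual (Q : MvPolynomial (Fin 2) ℚ) : Prop :=
  ∀ (r : IntegralRep 2) (P : MvPolynomial (Fin 2) ℚ), P ∉ Brieskorn Q →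
    r.domain = Set.pi Set.univ (fun _ : Fin 2 => Set.Icc (0:ℝ) 1) →
    (∀ z ∈ Set.pi Set.univ (fun _ : Fin 2 => Set.Icc (0:ℝ) 1), MvPolynomial.aeval z Q ≠ 0) →
    (∀ z ∈ Set.pi Set.univ (fun _ : Fin 2 => Set.Icc (0:ℝ) 1), r.integrand z = MvPolynomial.aeval z P / MvPolynomial.aeval z Q) →
    r.value = 0 → ∃ N : ℕ, (fun y : FormalRep => of piRep * y)^[N] (of r) ∈ relations

/-- **THE m = 2 SLICE OF 26322 ⟸ the Brieskorn residuals of all denominators (PROVED split; SPECIAL = Brieskorn module, decided with N = 0 for every Q;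
GENERIC = the `μ(Q)`-dimensional quotient).** [folklore] -/
theorem two_single_of_brieskornResidual (hres : ∀ Q : MvPolynomial (Fin 2) ℚ, BrieskornResidual Q)
    (r : IntegralRep 2) (P Q : MvPolynomial (Fin 2) ℚ)
    (hd : r.domain = Set.pi Set.univ (fun _ : Fin 2 => Set.Icc (0:ℝ) 1))
    (hQ : ∀ z ∈ Set.pi Set.univ (fun _ : Fin 2 => Set.Icc (0:ℝ) 1), MvPolynomial.aeval z Q ≠ 0)
    (hf : ∀ z ∈ Set.pi Set.univ (fun _ : Fin 2 => Set.Icc (0:ℝ) 1), r.integrand z = MvPolynomial.aeval z P / MvPolynomial.aeval z Q)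
    (h0 : r.value = 0) : ∃ N : ℕ, (fun y : FormalRep => of piRep * y)^[N] (of r) ∈ relations := by
  by_cases hP : P ∈ Brieskorn Q
  · exact ⟨0, by simpa using brieskorn_two_mem_relations Q r P hP hd hQ hf h0⟩
  · exact hres Q r P hP hd hQ hf h0

/-! ### §16b Examples: Brieskorn elements by hand -/

/-- Over ANY `Q`: `Q_x = {Q, y}` and `−Q_y = {Q, x}` are Brieskorn, hence exact. -/
example (Q : MvPolynomial (Fin 2) ℚ) : pderiv 0 Q ∈ Brieskorn Q := by
  have : pb Q (X 1) = pderiv 0 Q := by simp [pb]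
  rw [← this]; exact pb_mem_brieskorn Q (X 1)

example (Q : MvPolynomial (Fin 2) ℚ) : DRExact (pderiv 1 Q) Q := by
  have h1 : pb Q (X 0) = -pderiv 1 Q := by simp [pb]
  have : pderiv 1 Q = (-1 : ℚ) • pb Q (X 0) := by rw [h1]; simp
  rw [this]
  exact drExact_of_brieskorn (Submodule.smul_mem _ _ (pb_mem_brieskorn Q (X 0)))

end Summit.KontsevichZagierPeriods.RootDecompRationalCubeDichotomy.Rung26322.RankDescent
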